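import Literature.Probability.Percolation.InvasionPercolation
import HarnessLib

/-!
# The wired minimal spanning forest via finite cuts (Lyons–Peres–Schramm 2006, §3)

Definition only.  For a locally finite simple graph `G` and edge labels `U : Sym2 V → ℝ`, Lyons–Peres–Schramm (Ann. Probab. 34 (2006), §3, p. 1671) define the
wired minimal spanning forest `𝔉_w(U)` as the set of edges `e` such that every extended path joining the endpoints of `e` contains an edge `e'` with
`U(e') ≥ U(e)`, and note: "Equivalently, `𝔉_w(U)` consists of those edges `e` such that there is a finite set of vertices `W ⊂ V` where `e` is the least
edge joining `W` to `V ∖ W`" (also Lyons–Peres 2016, Exercise 11.5).  We take the finite-cut form as the definition, with "least" read STRICTLY: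

* `wmsf G U` — the set of bonds `e` of `G` for which some finite `W` has `e` in its edge boundary (`e = s(a.1, a.2)` for a boundary dart `a` of `W`, in the
  vocabulary of `InvasionPercolation.lean`) with `U e < U e'` for every OTHER boundary bond `e'` of `W`.

For injective labels (almost every `U` under the i.i.d. uniform label measure) this is exactly `𝔉_w(U)`; without injectivity it is the set
`{e : U(e) < Z_w(e)}` of Lyons–Peres–Schramm 2006, §3 (display before Lemma 3.1: `{e; U(e) < Z_w(e)} ⊆ 𝔉_w(U) ⊆ {e; U(e) ≤ Z_w(e)}`, with (3.2) for
`Z_w` as a supremum over finite cuts).  When `U` is drawn from the product measure, the law of `wmsf G U` is the WMSF of `G`.  The relation to invasion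
trees (LPS06 Prop. 3.3: `⋃_v T_U(v) = 𝔉_w(U)`) is proved in `Summits/…/PercNearOneGluingNoHeavyRsw3InvasionWMSF.lean`, not here.

## References
* R. Lyons, Y. Peres, O. Schramm, *Minimal spanning forests*, Ann. Probab. 34 (2006) 1665–1692, §3 (p. 1671; (3.2); Prop. 3.3) [LyonsPeresSchramm2006].
* R. Lyons, Y. Peres, *Probability on Trees and Networks*, CUP 2016, §11.2, Exercise 11.5 [LyonsPeres2016].
-/

noncomputable section

namespace Literature.Probability.Percolation

variable {V : Type*} [DecidableEq V] (G : SimpleGraph V) [G.LocallyFinite]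

/-- **The wired minimal spanning forest `𝔉_w(U)`** of the labelled graph `(G, U)`, in Lyons–Peres–Schramm's finite-cut form: the bonds `e` of `G` such that,
for some finite vertex set `W`, `e` joins `W` to its complement and has STRICTLY the smallest label among all bonds joining `W` to its complement.
(For injective `U` this is `𝔉_w(U)`; in general it is LPS's `{e : U(e) < Z_w(e)} ⊆ 𝔉_w(U)`.)
[cite: LyonsPeresSchramm2006, §3 (p. 1671: "𝔉_w(U) consists of those edges e such that there is a finite set of vertices W where e is the least edge joining W to V ∖ W")] -/
def wmsf (U : Sym2 V → ℝ) : Set (Sym2 V) :=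
  {e | ∃ W : Finset V, ∃ a ∈ Invasion.boundaryDarts G W, s(a.1, a.2) = e ∧
    ∀ b ∈ Invasion.boundaryDarts G W, s(b.1, b.2) ≠ e → U e < U s(b.1, b.2)}

/-- Membership in `wmsf`, unfolded. [cite: LyonsPeresSchramm2006, §3 (p. 1671)] -/
theorem mem_wmsf {U : Sym2 V → ℝ} {e : Sym2 V} :
    e ∈ wmsf G U ↔ ∃ W : Finset V, ∃ a ∈ Invasion.boundaryDarts G W, s(a.1, a.2) = e ∧
      ∀ b ∈ Invasion.boundaryDarts G W, s(b.1, b.2) ≠ e → U e < U s(b.1, b.2) :=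
  Iff.rfl

/-- Every bond of `wmsf G U` is a bond of `G`. [cite: LyonsPeresSchramm2006, §3 (p. 1671)] -/
theorem mem_edgeSet_of_mem_wmsf {U : Sym2 V → ℝ} {e : Sym2 V} (h : e ∈ wmsf G U) : e ∈ G.edgeSet := by
  obtain ⟨W, a, ha, rfl, -⟩ := h
  exact ((Invasion.mem_boundaryDarts G).1 ha).2.2

end Literature.Probability.Percolation
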